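import Summits.KontsevichZagierPeriods.KontsevichZagierPeriods.Theorems.PlanarK0Injective.Negative.Kit
import Literature.NumberTheory.Transcendental.KZLogCalculusProofs

/-!
# `PlanarCompiler` (stmt-KontsevichZagierPeriods-10058), line `twist-restoring-shear` — Green bookkeeping I

Helper file for the lead's stub `stub_greenAssembly` (crux protocol, `--supports`): bookkeeping in the
planar set-chain group `planarGroup` (= the group `G` of the crux) that does not depend on the Green
datum:

* `of_sub_sum_mem_planarGroup` — FINITE CUTS: an integrand-`1` planar representation is, in `G`, the
  sum of integrand-`1` representations on finitely many pairwise disjoint `ℚ`-semialgebraic pieces of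
  its domain covering it up to a null set (iterated rule 1a + the null piece);
* `Θ`-bookkeeping for a map `Θ` that kills the 1-dimensional instances of rules 1a / 1b / 2 (the
  hypothesis `hmoves` is the conclusion of the line's `stub_elementaryMoves`, taken verbatim) and has
  the cell property (`hcell`, the conclusion of `stub_cellCompiler`): congruence of representations
  that agree on their common domain (`theta_congr`), finite cuts in dimension one (`theta_sub_sum`),
  representations on null domains (`theta_null`), the reflection `t ↦ 1 − t` (`theta_reflect`).

No new definitions. [Kontsevich–Zagier 2001, §1.2; folklore bookkeeping]
-/

noncomputable section

open MeasureTheory Set MvPolynomial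
open Literature.NumberTheory.Transcendental Literature.ModelTheory.ExponentialFields
open Summit.KontsevichZagierPeriods.SymplecticScissors.PlanarK0InjectiveNegative

namespace Summit.KontsevichZagierPeriods.SymplecticScissors.PlanarCompilerProof

/-! ## Finite cuts among planar integrand-`1` representations -/

/-- Rule 1a between integrand-`1` planar representations is a generator of `planarGroup`. [folklore] -/
theorem of_sub_of_sub_of_mem_planarGroup_of_cut {r r₁ r₂ : KZ.IntegralRep 2}
    (hr : ∀ p ∈ r.domain, r.integrand p = 1) (hr₁ : ∀ p ∈ r₁.domain, r₁.integrand p = 1)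
    (hr₂ : ∀ p ∈ r₂.domain, r₂.integrand p = 1)
    (h : KZ.of r - KZ.of r₁ - KZ.of r₂ ∈ KZ.domainAddRel) :
    KZ.of r - KZ.of r₁ - KZ.of r₂ ∈ planarGroup :=
  AddSubgroup.subset_closure ⟨Or.inl h, sub_mem (sub_mem
    (AddSubgroup.subset_closure ⟨r, hr, rfl⟩) (AddSubgroup.subset_closure ⟨r₁, hr₁, rfl⟩))
    (AddSubgroup.subset_closure ⟨r₂, hr₂, rfl⟩)⟩

/-- Rule 2 between integrand-`1` planar representations is a generator of `planarGroup`. [folklore] -/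
theorem of_sub_of_mem_planarGroup_of_cov {r r' : KZ.IntegralRep 2}
    (hr : ∀ p ∈ r.domain, r.integrand p = 1) (hr' : ∀ p ∈ r'.domain, r'.integrand p = 1)
    (h : KZ.of r - KZ.of r' ∈ KZ.changeOfVariablesRel) : KZ.of r - KZ.of r' ∈ planarGroup :=
  AddSubgroup.subset_closure ⟨Or.inr h, sub_mem (AddSubgroup.subset_closure ⟨r, hr, rfl⟩)
    (AddSubgroup.subset_closure ⟨r', hr', rfl⟩)⟩

/-- Cutting one `ℚ`-semialgebraic piece `P ⊆ r.domain` off an integrand-`1` planar representation: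
`[r] ≡ [r|P] + [r|(r.domain ∖ P)]` in `planarGroup` (rule 1a with empty overlap). [folklore] -/
theorem of_sub_of_restrict_sub_of_restrict_mem_planarGroup (r : KZ.IntegralRep 2)
    (hr : ∀ p ∈ r.domain, r.integrand p = 1) {P : Set (Fin 2 → ℝ)} (hP : IsSemialgebraic ℚ P)
    (hPr : P ⊆ r.domain) :
    KZ.of r - KZ.of (r.restrict P hP hPr)
      - KZ.of (r.restrict (r.domain \ P) (r.isSemialgebraic_domain.diff hP) Set.sdiff_subset)
        ∈ planarGroup := by
  refine of_sub_of_sub_of_mem_planarGroup_of_cut hr (fun p hp => hr p (hPr hp))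
    (fun p hp => hr p hp.1) ⟨2, r, r.restrict P hP hPr,
      r.restrict (r.domain \ P) (r.isSemialgebraic_domain.diff hP) Set.sdiff_subset,
      ?_, ?_, fun _ _ => rfl, fun _ _ => rfl, rfl⟩
  · simp [Set.union_sdiff_cancel hPr]
  · simp

/-- **Finite cuts.** If finitely many pairwise disjoint `ℚ`-semialgebraic pieces `P i ⊆ r.domain`
cover the domain of an integrand-`1` planar representation up to a null set, then `[r]` is the sum
of the integrand-`1` representations `e i` on the pieces, in `planarGroup`. [folklore] -/
theorem of_sub_sum_mem_planarGroup {ι : Type*} (s : Finset ι) :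
    ∀ (r : KZ.IntegralRep 2), (∀ p ∈ r.domain, r.integrand p = 1) →
    ∀ (P : ι → Set (Fin 2 → ℝ)) (e : ι → KZ.IntegralRep 2),
      (∀ i ∈ s, IsSemialgebraic ℚ (P i)) → (∀ i ∈ s, P i ⊆ r.domain) →
      (∀ i ∈ s, ∀ j ∈ s, i ≠ j → Disjoint (P i) (P j)) →
      volume (r.domain \ ⋃ i ∈ s, P i) = 0 →
      (∀ i ∈ s, (e i).domain = P i) → (∀ i ∈ s, ∀ p ∈ (e i).domain, (e i).integrand p = 1) →
      KZ.of r - ∑ i ∈ s, KZ.of (e i) ∈ planarGroup := by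
  classical
  induction s using Finset.induction_on with
  | empty =>
    intro r hr P e _ _ _ hnull _ _
    simp only [Finset.notMem_empty, iUnion_of_empty, iUnion_empty, Set.sdiff_empty] at hnull
    simpa using of_mem_planarGroup_of_volume_eq_zero r hr hnull
  | insert a s ha ih =>
    intro r hr P e hP hPr hdisj hnull hed hei
    have haP : IsSemialgebraic ℚ (P a) := hP a (Finset.mem_insert_self a s)
    have haPr : P a ⊆ r.domain := hPr a (Finset.mem_insert_self a s)
    -- cut `P a` off
    set r' := r.restrict (r.domain \ P a) (r.isSemialgebraic_domain.diff haP) Set.sdiff_subset with hr'_def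
    have h1 := of_sub_of_restrict_sub_of_restrict_mem_planarGroup r hr haP haPr
    have h2 : KZ.of (r.restrict (P a) haP haPr) - KZ.of (e a) ∈ planarGroup :=
      of_sub_of_mem_planarGroup_of_domain_eq _ _ (fun p hp => hr p (haPr hp))
        (hei a (Finset.mem_insert_self a s)) (by simp [hed a (Finset.mem_insert_self a s)])
    -- induction hypothesis for the rest
    have h3 : KZ.of r' - ∑ i ∈ s, KZ.of (e i) ∈ planarGroup := by
      refine ih r' (fun p hp => hr p hp.1) P e (fun i hi => hP i (Finset.mem_insert_of_mem hi))
        (fun i hi => ?_) (fun i hi j hj hij => hdisj i (Finset.mem_insert_of_mem hi) j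
          (Finset.mem_insert_of_mem hj) hij) ?_ (fun i hi => hed i (Finset.mem_insert_of_mem hi))
        (fun i hi => hei i (Finset.mem_insert_of_mem hi))
      · intro p hp
        refine ⟨hPr i (Finset.mem_insert_of_mem hi) hp, fun hpa => ?_⟩
        have hia : i ≠ a := fun h => ha (h ▸ hi)
        exact Set.disjoint_left.mp (hdisj i (Finset.mem_insert_of_mem hi) a
          (Finset.mem_insert_self a s) hia) hp hpa
      · have hEq : r'.domain \ ⋃ i ∈ s, P i = r.domain \ ⋃ i ∈ insert a s, P i := by
          ext p
          simp only [hr'_def, KZ.IntegralRep.domain_restrict, Set.mem_sdiff, mem_iUnion, exists_prop,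
            not_exists, not_and, Finset.mem_insert, forall_eq_or_imp]
          tauto
        rw [hEq]; exact hnull
    have hsplit : KZ.of r - ∑ i ∈ insert a s, KZ.of (e i) =
        (KZ.of r - KZ.of (r.restrict (P a) haP haPr) - KZ.of r') +
          (KZ.of (r.restrict (P a) haP haPr) - KZ.of (e a)) + (KZ.of r' - ∑ i ∈ s, KZ.of (e i)) := by
      rw [Finset.sum_insert ha]; abel
    rw [hsplit]
    exact add_mem (add_mem h1 h2) h3

/-! ## `Θ`-bookkeeping in dimension one -/

section Theta

variable (Θ : KZ.FormalRep →+ KZ.FormalRep)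

/-- The group `G` of the crux is `planarGroup` (definitional). [folklore] -/
theorem planarGroup_eq :
    AddSubgroup.closure ((KZ.domainAddRel ∪ KZ.changeOfVariablesRel) ∩
      (AddSubgroup.closure {x : KZ.FormalRep | ∃ s : KZ.IntegralRep 2,
        (∀ p ∈ s.domain, s.integrand p = 1) ∧ x = KZ.of s} : Set KZ.FormalRep)) = planarGroup := rfl

/-- If `Θ` kills the 1-dimensional instances of rule 2, two 1-dimensional representations with the
same domain whose integrands agree ON the domain have congruent `Θ`-images (rule 2 with `Φ = id`).
[folklore] -/
theorem theta_congr
    (hmoves : ∀ x ∈ KZ.domainAddRel ∪ KZ.integrandAddRel ∪ KZ.changeOfVariablesRel, Θ x ∈ planarGroup)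
    {ρ ρ' : KZ.IntegralRep 1} (hd : ρ'.domain = ρ.domain) (h : EqOn ρ.integrand ρ'.integrand ρ.domain) :
    Θ (KZ.of ρ) - Θ (KZ.of ρ') ∈ planarGroup := by
  rw [← map_sub]
  refine hmoves _ (Or.inr ⟨1, ρ, ρ', id, fun _ => ContinuousLinearMap.id ℝ (Fin 1 → ℝ),
    isSemialgebraicMapOn_id ρ.isSemialgebraic_domain, fun x _ => hasFDerivWithinAt_id x _,
    injOn_id _, by simp [hd], fun x hx => ?_, rfl⟩)
  simp [h hx, ContinuousLinearMap.det]

/-- If `Θ` kills the 1-dimensional instances of rule 1a: cutting a `ℚ`-semialgebraic piece off a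
1-dimensional representation. [folklore] -/
theorem theta_sub_restrict_sub_restrict
    (hmoves : ∀ x ∈ KZ.domainAddRel ∪ KZ.integrandAddRel ∪ KZ.changeOfVariablesRel, Θ x ∈ planarGroup)
    (ρ : KZ.IntegralRep 1) {P : Set (Fin 1 → ℝ)} (hP : IsSemialgebraic ℚ P) (hPρ : P ⊆ ρ.domain) :
    Θ (KZ.of ρ) - Θ (KZ.of (ρ.restrict P hP hPρ))
      - Θ (KZ.of (ρ.restrict (ρ.domain \ P) (ρ.isSemialgebraic_domain.diff hP) Set.sdiff_subset))
        ∈ planarGroup := by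
  rw [← map_sub, ← map_sub]
  refine hmoves _ (Or.inl (Or.inl ⟨1, ρ, ρ.restrict P hP hPρ,
    ρ.restrict (ρ.domain \ P) (ρ.isSemialgebraic_domain.diff hP) Set.sdiff_subset,
    ?_, ?_, fun _ _ => rfl, fun _ _ => rfl, rfl⟩))
  · simp [Set.union_sdiff_cancel hPρ]
  · simp

/-- The cells of `Θ` over a null 1-dimensional domain are null, so `Θ [ρ] ∈ planarGroup` whenever
`ρ.domain` is null (cell property of `Θ`). [folklore] -/
theorem theta_null
    (hcell : ∀ ρ : KZ.IntegralRep 1, ∃ s t : KZ.IntegralRep 2,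
      s.domain = {p : Fin 2 → ℝ | (fun _ : Fin 1 => p 0) ∈ ρ.domain ∧ 0 < p 1 ∧
        p 1 < ρ.integrand (fun _ : Fin 1 => p 0)} ∧
      t.domain = {p : Fin 2 → ℝ | (fun _ : Fin 1 => p 0) ∈ ρ.domain ∧ 0 < p 1 ∧
        p 1 < -ρ.integrand (fun _ : Fin 1 => p 0)} ∧
      (∀ p ∈ s.domain, s.integrand p = 1) ∧ (∀ p ∈ t.domain, t.integrand p = 1) ∧
      Θ (KZ.of ρ) = KZ.of s - KZ.of t)
    (ρ : KZ.IntegralRep 1) (h0 : volume ρ.domain = 0) : Θ (KZ.of ρ) ∈ planarGroup := by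
  obtain ⟨s, t, hs, ht, hs1, ht1, hΘ⟩ := hcell ρ
  have hinit : ∀ p : Fin 2 → ℝ, (fun _ : Fin 1 => p 0) = Fin.init p := fun p => by
    ext i; fin_cases i; rfl
  have hcyl : volume {p : Fin 2 → ℝ | Fin.init p ∈ ρ.domain} = 0 :=
    KZ.volume_setOf_init_mem_eq_zero h0
  have hs0 : volume s.domain = 0 :=
    measure_mono_null (fun p hp => by rw [hs] at hp; simpa [hinit p] using hp.1) hcyl
  have ht0 : volume t.domain = 0 :=
    measure_mono_null (fun p hp => by rw [ht] at hp; simpa [hinit p] using hp.1) hcyl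
  rw [hΘ]
  exact sub_mem (of_mem_planarGroup_of_volume_eq_zero s hs1 hs0)
    (of_mem_planarGroup_of_volume_eq_zero t ht1 ht0)

/-- **Finite cuts in dimension one under `Θ`.** If finitely many pairwise disjoint
`ℚ`-semialgebraic pieces `P i ⊆ ρ.domain` cover it up to a null set and `ρ i` are representations
on the pieces agreeing with `ρ` there, then `Θ [ρ] ≡ ∑ Θ [ρ i]` in `planarGroup`. [folklore] -/
theorem theta_sub_sum
    (hcell : ∀ ρ : KZ.IntegralRep 1, ∃ s t : KZ.IntegralRep 2,
      s.domain = {p : Fin 2 → ℝ | (fun _ : Fin 1 => p 0) ∈ ρ.domain ∧ 0 < p 1 ∧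
        p 1 < ρ.integrand (fun _ : Fin 1 => p 0)} ∧
      t.domain = {p : Fin 2 → ℝ | (fun _ : Fin 1 => p 0) ∈ ρ.domain ∧ 0 < p 1 ∧
        p 1 < -ρ.integrand (fun _ : Fin 1 => p 0)} ∧
      (∀ p ∈ s.domain, s.integrand p = 1) ∧ (∀ p ∈ t.domain, t.integrand p = 1) ∧
      Θ (KZ.of ρ) = KZ.of s - KZ.of t)
    (hmoves : ∀ x ∈ KZ.domainAddRel ∪ KZ.integrandAddRel ∪ KZ.changeOfVariablesRel, Θ x ∈ planarGroup)
    {ι : Type*} (s : Finset ι) :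
    ∀ (ρ : KZ.IntegralRep 1) (P : ι → Set (Fin 1 → ℝ)) (e : ι → KZ.IntegralRep 1),
      (∀ i ∈ s, IsSemialgebraic ℚ (P i)) → (∀ i ∈ s, P i ⊆ ρ.domain) →
      (∀ i ∈ s, ∀ j ∈ s, i ≠ j → Disjoint (P i) (P j)) →
      volume (ρ.domain \ ⋃ i ∈ s, P i) = 0 →
      (∀ i ∈ s, (e i).domain = P i) → (∀ i ∈ s, EqOn ρ.integrand (e i).integrand (P i)) →
      Θ (KZ.of ρ) - ∑ i ∈ s, Θ (KZ.of (e i)) ∈ planarGroup := by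
  classical
  induction s using Finset.induction_on with
  | empty =>
    intro ρ P e _ _ _ hnull _ _
    simp only [Finset.notMem_empty, iUnion_of_empty, iUnion_empty, Set.sdiff_empty] at hnull
    simpa using theta_null Θ hcell ρ hnull
  | insert a s ha ih =>
    intro ρ P e hP hPρ hdisj hnull hed hei
    have haP : IsSemialgebraic ℚ (P a) := hP a (Finset.mem_insert_self a s)
    have haPρ : P a ⊆ ρ.domain := hPρ a (Finset.mem_insert_self a s)
    set ρ' := ρ.restrict (ρ.domain \ P a) (ρ.isSemialgebraic_domain.diff haP) Set.sdiff_subset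
      with hρ'_def
    have h1 := theta_sub_restrict_sub_restrict Θ hmoves ρ haP haPρ
    have h2 : Θ (KZ.of (ρ.restrict (P a) haP haPρ)) - Θ (KZ.of (e a)) ∈ planarGroup :=
      theta_congr Θ hmoves (by simp [hed a (Finset.mem_insert_self a s)])
        (fun x hx => hei a (Finset.mem_insert_self a s) hx)
    have h3 : Θ (KZ.of ρ') - ∑ i ∈ s, Θ (KZ.of (e i)) ∈ planarGroup := by
      refine ih ρ' P e (fun i hi => hP i (Finset.mem_insert_of_mem hi)) (fun i hi => ?_)
        (fun i hi j hj hij => hdisj i (Finset.mem_insert_of_mem hi) j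
          (Finset.mem_insert_of_mem hj) hij) ?_ (fun i hi => hed i (Finset.mem_insert_of_mem hi))
        (fun i hi x hx => hei i (Finset.mem_insert_of_mem hi) hx)
      · intro p hp
        refine ⟨hPρ i (Finset.mem_insert_of_mem hi) hp, fun hpa => ?_⟩
        have hia : i ≠ a := fun h => ha (h ▸ hi)
        exact Set.disjoint_left.mp (hdisj i (Finset.mem_insert_of_mem hi) a
          (Finset.mem_insert_self a s) hia) hp hpa
      · have hEq : ρ'.domain \ ⋃ i ∈ s, P i = ρ.domain \ ⋃ i ∈ insert a s, P i := by
          ext p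
          simp only [hρ'_def, KZ.IntegralRep.domain_restrict, Set.mem_sdiff, mem_iUnion, exists_prop,
            not_exists, not_and, Finset.mem_insert, forall_eq_or_imp]
          tauto
        rw [hEq]; exact hnull
    have hsplit : Θ (KZ.of ρ) - ∑ i ∈ insert a s, Θ (KZ.of (e i)) =
        (Θ (KZ.of ρ) - Θ (KZ.of (ρ.restrict (P a) haP haPρ)) - Θ (KZ.of ρ')) +
          (Θ (KZ.of (ρ.restrict (P a) haP haPρ)) - Θ (KZ.of (e a))) +
          (Θ (KZ.of ρ') - ∑ i ∈ s, Θ (KZ.of (e i))) := by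
      rw [Finset.sum_insert ha]; abel
    rw [hsplit]
    exact add_mem (add_mem h1 h2) h3

/-- If `Θ` kills the 1-dimensional instances of rule 1b: additivity in the integrand under `Θ`.
[folklore] -/
theorem theta_add
    (hmoves : ∀ x ∈ KZ.domainAddRel ∪ KZ.integrandAddRel ∪ KZ.changeOfVariablesRel, Θ x ∈ planarGroup)
    {ρ ρ₁ ρ₂ : KZ.IntegralRep 1} (h₁ : ρ₁.domain = ρ.domain) (h₂ : ρ₂.domain = ρ.domain)
    (h : EqOn ρ.integrand (ρ₁.integrand + ρ₂.integrand) ρ.domain) :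
    Θ (KZ.of ρ) - Θ (KZ.of ρ₁) - Θ (KZ.of ρ₂) ∈ planarGroup := by
  rw [← map_sub, ← map_sub]
  exact hmoves _ (Or.inl (Or.inr ⟨1, ρ, ρ₁, ρ₂, h₁, h₂, h, rfl⟩))

/-- If `Θ` kills the 1-dimensional instances of rule 2: the reflection `t ↦ 1 − t` of the unit
interval, `Θ [∫₀¹ f(1 − t) dt] ≡ Θ [∫₀¹ f(t) dt]`. Here `ρ.integrand z = ρ'.integrand (1 − z)` on the
common domain `{z | z 0 ∈ (0,1)}`. [folklore] -/
theorem theta_reflect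
    (hmoves : ∀ x ∈ KZ.domainAddRel ∪ KZ.integrandAddRel ∪ KZ.changeOfVariablesRel, Θ x ∈ planarGroup)
    {ρ ρ' : KZ.IntegralRep 1} (hd : ρ.domain = {z : Fin 1 → ℝ | z 0 ∈ Ioo (0 : ℝ) 1})
    (hd' : ρ'.domain = {z : Fin 1 → ℝ | z 0 ∈ Ioo (0 : ℝ) 1})
    (h : ∀ z ∈ ρ.domain, ρ.integrand z = ρ'.integrand (fun _ => 1 - z 0)) :
    Θ (KZ.of ρ) - Θ (KZ.of ρ') ∈ planarGroup := by
  rw [← map_sub]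
  -- the reflection as a map of `ℝ¹` and its (constant) derivative `-id`
  set Φ : (Fin 1 → ℝ) → (Fin 1 → ℝ) := fun z _ => 1 - z 0 with hΦ
  set L : (Fin 1 → ℝ) →L[ℝ] (Fin 1 → ℝ) := -ContinuousLinearMap.id ℝ (Fin 1 → ℝ) with hL
  have hΦ_eq : ∀ z : Fin 1 → ℝ, Φ z = (fun _ : Fin 1 => (1 : ℝ)) - z := fun z => by
    ext i; fin_cases i; simp [hΦ]
  have hderiv : ∀ z, HasFDerivAt Φ L z := fun z => by
    have h1 : HasFDerivAt (fun z : Fin 1 → ℝ => (fun _ : Fin 1 => (1 : ℝ)) - z)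
        ((0 : (Fin 1 → ℝ) →L[ℝ] (Fin 1 → ℝ)) - ContinuousLinearMap.id ℝ (Fin 1 → ℝ)) z :=
      (hasFDerivAt_const (fun _ : Fin 1 => (1 : ℝ)) z).sub (hasFDerivAt_id z)
    have h2 : Φ = fun z => (fun _ : Fin 1 => (1 : ℝ)) - z := funext hΦ_eq
    rw [h2, hL]
    convert h1 using 1
    simp
  have hdet : |L.det| = 1 := by
    have hlin : (L : (Fin 1 → ℝ) →ₗ[ℝ] (Fin 1 → ℝ)) =
        (-1 : ℝ) • (LinearMap.id : (Fin 1 → ℝ) →ₗ[ℝ] (Fin 1 → ℝ)) := by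
      ext v i; simp [hL]
    rw [ContinuousLinearMap.det, hlin, LinearMap.det_smul, LinearMap.det_id]
    simp
  refine hmoves _ (Or.inr ⟨1, ρ, ρ', Φ, fun _ => L, ?_, fun z _ => (hderiv z).hasFDerivWithinAt,
    ?_, ?_, fun z hz => ?_, rfl⟩)
  · -- semialgebraic: a polynomial map
    refine (isSemialgebraicMapOn_aeval ρ.isSemialgebraic_domain ![C 1 - X 0]).congr ?_
    intro z _; ext i; fin_cases i; simp [hΦ]
  · intro z hz w hw hzw
    have := congr_fun hzw 0
    simp only [hΦ] at this
    ext i; fin_cases i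
    simpa using (show z 0 = w 0 by linarith)
  · ext w
    rw [hd, hd', mem_image]
    constructor
    · intro hw
      have hw' : 0 < w 0 ∧ w 0 < 1 := hw
      refine ⟨fun _ => 1 - w 0, ?_, ?_⟩
      · show 0 < 1 - w 0 ∧ 1 - w 0 < 1
        constructor <;> linarith [hw'.1, hw'.2]
      · ext i; fin_cases i; simp [hΦ]
    · rintro ⟨z, hz, rfl⟩
      have hz' : 0 < z 0 ∧ z 0 < 1 := hz
      show 0 < 1 - z 0 ∧ 1 - z 0 < 1
      constructor <;> linarith [hz'.1, hz'.2]
  · rw [h z hz, hdet, mul_one]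

end Theta

/-- Registered anchor of this helper file (crux protocol `--supports`): the reflection `t ↦ 1 − t` under `Θ` (`theta_reflect`). [folklore] -/
theorem stub_greenAux1 :
    ∀ Θ : KZ.FormalRep →+ KZ.FormalRep, (∀ x ∈ KZ.domainAddRel ∪ KZ.integrandAddRel ∪ KZ.changeOfVariablesRel, Θ x ∈ AddSubgroup.closure ((KZ.domainAddRel ∪ KZ.changeOfVariablesRel) ∩ (AddSubgroup.closure {x : KZ.FormalRep | ∃ s : KZ.IntegralRep 2, (∀ p ∈ s.domain, s.integrand p = 1) ∧ x = KZ.of s} : Set KZ.FormalRep))) → ∀ (ρ ρ' : KZ.IntegralRep 1), ρ.domain = {z : Fin 1 → ℝ | z 0 ∈ Set.Ioo 0 1} → ρ'.domain = {z : Fin 1 → ℝ | z 0 ∈ Set.Ioo 0 1} → (∀ z ∈ ρ.domain, ρ.integrand z = ρ'.integrand (fun _ : Fin 1 => 1 - z 0)) → Θ (KZ.of ρ) - Θ (KZ.of ρ') ∈ AddSubgroup.closure ((KZ.domainAddRel ∪ KZ.changeOfVariablesRel) ∩ (AddSubgroup.closure {x : KZ.FormalRep | ∃ s : KZ.IntegralRep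 2, (∀ p ∈ s.domain, s.integrand p = 1) ∧ x = KZ.of s} : Set KZ.FormalRep)) :=
  fun Θ h _ _ a b c => theta_reflect Θ h a b c

end Summit.KontsevichZagierPeriods.SymplecticScissors.PlanarCompilerProof
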